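import Literature.NumberTheory.Automorphic.Liu2021.NablaMapSurjectiveOfSurjective
import Mathlib.AlgebraicGeometry.Limits
import HarnessLib

/-!
# Lang, *Abelian Varieties* II §3 Prop. 7 in Liu's `∇`-normalisation: `Alb_u` is an epimorphism for every surjective morphism of
# smooth projective schemes — pieces-free forms

[Liu2021] = Yifeng Liu, *Fourier–Jacobi cycles and arithmetic relative trace formula*, Camb. J. Math. **9** (2021) =
arXiv:2102.11518 (`FJcycle.tex` line numbers as in `Liu2021/AppendixC/Glue.lean`).  PROOF FILE (theorems only; no definition,
no named fact, no instance, no `sorry`).  Sequel of ★ `Liu2021/NablaMapSurjectiveOfSurjective`, whose theorems take the complex pieces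
of `X ⊗_k ℂ`, `Y ⊗_k ℂ` (colimit cofans of geometrically irreducible complex schemes) as data; here the pieces are PRODUCED for smooth
projective schemes, so that the heads carry no piece data at all.

* `exists_isColimit_cofan_complex_of_isSmoothProjective` — **the complex pieces of a smooth projective scheme**: for `X` smooth of
  relative dimension `d` and projective over `k ⊆ ℂ` of characteristic zero, `X ⊗_k ℂ` is a finite coproduct (colimit cofan in
  `SchemeOver ℂ`) of smooth projective geometrically irreducible complex `d`-folds — the finite-Galois splitting ★
  `exists_isGalois_isColimit_isSmoothProjective_algPoints` (the decomposition «`X ⊗_k k' = ∐ X'`» of the proof of the Proposition of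
  §2.1, l. 1194–1200) base changed along a `k`-embedding `L → ℂ` (finite coproducts of schemes are universal; private twin of ★
  `nonempty_isColimit_cofan_bcFunctor` of `Liu2021/AlbaneseComplexJacobianModel`, re-proved to keep the Jacobian model out of the
  imports) and transported along `(X ⊗_k L) ⊗_L ℂ ≅ X ⊗_k ℂ` (★ `baseChangeHomObjIsoOfComp`).
* `Nabla.exists_comp_eq_of_surjective_of_smooth` — every `ℂ`-point of `∇X` lifts along `∇u` for every SURJECTIVE `u : Y → X` of smooth
  projective `k`-schemes (any carriers `∇X`, `∇Y`, `ν` over `u × u`).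
* `Albanese.epi_map_of_surjective_of_isSmoothProjective` — **`Alb_u : Alb_Y → Alb_X` is an EPIMORPHISM for every surjective morphism `u : Y → X` of
  smooth projective `k`-schemes** ([Lang1983AbelianVarieties] Ch. II §3 Prop. 7: «if `φ` is generically surjective then `φ_*` is
  generically surjective», `φ_*` the induced homomorphism of Prop. 5; here for possibly reducible pure-dimensional `X`, `Y` and with NO
  flatness of `u` — compare ★ `Albanese.epi_map_of_surjective` of `AppendixC/AlbaneseTraceIsogeny`, which needs `u` universally open).
* `SchemeOver.surjective_left_of_forall_algPoints`, `Nabla.surjective_left_of_surjective_of_smooth` — a universally closed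
  `K`-morphism onto which every `Ω`-point lifts (target locally of finite type) is SURJECTIVE (closed image ⊇ closed points, Jacobson);
  hence `∇u` is a surjective morphism of schemes for every surjective `u` of smooth projective `k`-schemes — the flatness-free form of ★
  `Nabla.surjective_map_left`.
* `Sec42Data.epi_Atr_of_surjective_transition` — for a §4.2 datum `C` (Liu's tower `X_K = S̃h(𝕍)_K`, `A_K = Alb X_K`, l. 2060–2072):
  **`Alb_{u^{K'}_K} = C.Atr f` is an epimorphism for every SURJECTIVE transition morphism `u^{K'}_K`**, with no further hypothesis
  (l. 2064 «generically finite dominant»): the flatness-free form of input (I) «`AlbTransitionEpi`» of the reduction of Thm. 4.18 (1)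
  (cell hodgecm-mathlib row VI-3, generic half).

HC_CM is proved only modulo the 7 printed citations until rung 0 closes; nothing here discharges a COR-CM binder.  Ours (formalisation
glue); axioms `propext`, `Classical.choice`, `Quot.sound`.

## References
* [Lang1983AbelianVarieties] S. Lang, *Abelian Varieties* (Interscience 1959; Springer 1983 reprint), Ch. II §3, Prop. 5 (p. 47) and Prop. 7 (p. 48).
* [Liu2021] Y. Liu, arXiv:2102.11518 = Camb. J. Math. 9 (2021): §2.1 Def. 2.1 (1) (l. 1171–1176), proof of the Proposition
  (l. 1194–1200), Def. 2.3 (l. 1202–1208), Lemma 2.4 (1) proof (l. 1220–1228), §4.2 l. 2060–2072, Thm. 4.18 (1) proof (l. 2247–2282).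
* [GortzWedhorn2020] U. Görtz, T. Wedhorn, *Algebraic Geometry I*, 2nd ed. (2020): (3.5) Example 3.11 (p. 73), (4.5) Prop. 4.16
  (p. 101), (4.7) (pp. 107–108), Prop. 4.32, Prop. 3.35 / Cor. 3.36 (p. 83) (closed points, Nullstellensatz).
* [StacksProject] The Stacks project, Tag 01TB (schemes locally of finite type over a field are Jacobson).
-/

set_option autoImplicit false

noncomputable section

open CategoryTheory CategoryTheory.Limits AlgebraicGeometry MonoidalCategory CartesianMonoidalCategory
open Literature.AlgebraicGeometry.Motives

namespace Literature.NumberTheory.Automorphic.Liu2021.AppendixC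

/-! ## §1 The complex pieces of a smooth projective scheme -/

section ComplexPieces

open AbelianVariety (bcSpec bcFunctor)

set_option backward.isDefEq.respectTransparency false

/-- Base change of a finite coproduct decomposition of `L`-schemes along a field extension `L → L'` is a coproduct decomposition
(finite coproducts of schemes are universal, Mathlib `FinitaryPreExtensive.isUniversal_finiteCoproducts`; the base-change squares are
cartesian, ★ `GaloisDescent.isPullback_bcFunctor_map_left`; `Over.forget` creates the coproduct, ★ `Morphisms.isColimit_cofan_left`).
PRIVATE TWIN of ★ `nonempty_isColimit_cofan_bcFunctor` (`Liu2021/AlbaneseComplexJacobianModel`), kept private here to avoid the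
Jacobian-model import. [cite: GortzWedhorn2020, (4.5) Prop. 4.16 (p. 101) and (4.7) (pp. 107–108) with (3.5) Example 3.11 (p. 73)] -/
private theorem nonempty_isColimit_cofan_bcFunctor_aux {L L' : Type} [Field L] [Field L'] [Algebra L L'] {C : Type} [Finite C]
    {E : C → SchemeOver L} {S : SchemeOver L} (e : ∀ c, E c ⟶ S) (hc : IsColimit (Cofan.mk S e)) :
    Nonempty (IsColimit (Cofan.mk ((bcFunctor L L').obj S) fun c => (bcFunctor L L').map (e c))) := by
  -- the underlying cofan of schemes is a colimit, hence a universal one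
  obtain ⟨hcS⟩ := Literature.AlgebraicGeometry.Morphisms.isColimit_cofan_left hc
  have hau : IsUniversalColimit (Cofan.mk S.left fun c => (e c).left) :=
    FinitaryPreExtensive.isUniversal_finiteCoproducts hcS
  -- pull it back along `Spec L' → Spec L`: the base-change squares are cartesian
  have hS' : Nonempty (IsColimit
      (Cofan.mk ((bcFunctor L L').obj S).left fun c => ((bcFunctor L L').map (e c)).left)) := by
    refine hau (Cofan.mk ((bcFunctor L L').obj S).left fun c => ((bcFunctor L L').map (e c)).left)
      (Discrete.natTrans fun c => pullback.fst (E c.as).hom (bcSpec L L')) (pullback.fst S.hom (bcSpec L L')) ?_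
      (NatTrans.Equifibered.of_discrete _) fun c => ?_
    · ext ⟨c⟩
      simp only [NatTrans.comp_app, Discrete.natTrans_app, Cofan.mk_ι_app, Functor.const_map_app]
      exact (GaloisDescent.bcFunctor_map_left_comp_fst L' (e c)).symm
    · exact GaloisDescent.isPullback_bcFunctor_map_left L' (e c.as)
  obtain ⟨hS'⟩ := hS'
  -- … and lift back to `SchemeOver L'` (`Over.forget` creates colimits)
  exact ⟨isColimitOfReflects (Over.forget _)
    ((Cofan.isColimitMapCoconeEquiv (Over.forget _) _ (Cofan.mk _ fun c => (bcFunctor L L').map (e c))).symm hS')⟩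

/-- Transport of a colimit cofan along an isomorphism of the apex, EXISTENTIAL form: if `(f_c : E_c ⟶ S)_c` is a colimit cofan and
`i : S ≅ S'`, then `S'` is the apex of a colimit cofan on the same pieces (namely `(f_c ≫ i)_c`; Mathlib `IsColimit.ofIsoColimit` +
`Cofan.ext`).  Stated for an ABSTRACT `i` and with the transported legs hidden behind `∃` — kernel device: with the concrete tower
identification `(X ⊗_k L) ⊗_L ℂ ≅ X ⊗_k ℂ` the kernel times out on the transported `IsColimit` term as soon as its legs are spelled out
(cf. the «abstract `eX`» device of ★ `Liu2021/AlbaneseBaseChangeComplexSplit`). [folklore] -/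
private theorem exists_isColimit_cofan_of_iso {L' : Type} [Field L'] {C : Type} {E : C → SchemeOver L'} {S S' : SchemeOver L'}
    (f : ∀ c, E c ⟶ S) (hc : IsColimit (Cofan.mk S f)) (i : S ≅ S') :
    ∃ g : ∀ c, E c ⟶ S', Nonempty (IsColimit (Cofan.mk S' g)) :=
  ⟨fun c => f c ≫ i.hom, ⟨hc.ofIsoColimit (Cofan.ext i fun _ => rfl)⟩⟩

variable {k : Type} [Field k] [Algebra k ℂ]

/-- **The complex pieces of a smooth projective scheme.**  For `X` smooth of relative dimension `d` and projective over a field `k ⊆ ℂ` of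
characteristic zero, `X ⊗_k ℂ` is a FINITE COPRODUCT of smooth projective geometrically irreducible complex `d`-folds: split `X` over a
finite Galois `L / k` into smooth projective geometrically irreducible pieces (★ `exists_isGalois_isColimit_isSmoothProjective_algPoints`,
the `k'`-decomposition «`X ⊗_k k' = ∐ X'`» of the proof of the Proposition, l. 1194–1200), embed `L → ℂ` over `k`
(`IsAlgClosed.lift`), base change the cofan (finite coproducts are universal) and identify `(X ⊗_k L) ⊗_L ℂ ≅ X ⊗_k ℂ`
(★ `baseChangeHomObjIsoOfComp`, typed ONCE over `bcFunctor` and kept abstract afterwards — kernel device).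
[cite: Liu2021, §2.1 proof of the Proposition (l. 1194–1200) and Lemma 2.4 (1) proof (l. 1220–1228)]
[cite: GortzWedhorn2020, (4.5) Prop. 4.16 (p. 101), (4.7) (pp. 107–108), (3.5) Example 3.11 (p. 73)] -/
theorem exists_isColimit_cofan_complex_of_isSmoothProjective [CharZero k] {d : ℕ} (X : SchemeOver k)
    [SmoothOfRelativeDimension d X.hom] (hX : IsProjectiveOver X) :
    ∃ (κ : Type) (_ : Finite κ) (P : κ → SchemeOver ℂ) (inj : ∀ c, P c ⟶ (bcFunctor k ℂ).obj X),
      (∀ c, IsSmoothProjective d (P c)) ∧ Nonempty (IsColimit (Cofan.mk ((bcFunctor k ℂ).obj X) inj)) := by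
  obtain ⟨L, _, _, _, _, C, _, E, e, hE, -, ⟨hcolL⟩⟩ :=
    exists_isGalois_isColimit_isSmoothProjective_algPoints (d := d) X hX
  -- a `k`-embedding `L → ℂ`
  letI : Algebra L ℂ := ((IsAlgClosed.lift : L →ₐ[k] ℂ) : L →+* ℂ).toAlgebra
  have hτ : (algebraMap L ℂ).comp (algebraMap k L) = algebraMap k ℂ := (IsAlgClosed.lift : L →ₐ[k] ℂ).comp_algebraMap
  -- the tower identification `(X ⊗_k L) ⊗_L ℂ ≅ X ⊗_k ℂ`, typed over `bcFunctor` once and kept abstract below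
  have eX : (bcFunctor L ℂ).obj ((bcFunctor k L).obj X) ≅ (bcFunctor k ℂ).obj X :=
    baseChangeHomObjIsoOfComp (algebraMap k L) (algebraMap L ℂ) (algebraMap k ℂ) hτ X
  -- the complexified pieces are smooth projective (geometrically irreducible) `d`-folds
  have hE' : ∀ c, IsSmoothProjective d ((bcFunctor L ℂ).obj (E c)) := fun c => (hE c).baseChange_obj ℂ
  -- the complexified cofan, transported along `eX`
  obtain ⟨hC⟩ := nonempty_isColimit_cofan_bcFunctor_aux (L' := ℂ) e hcolL
  obtain ⟨inj, hinj⟩ := exists_isColimit_cofan_of_iso (fun c => (bcFunctor L ℂ).map (e c)) hC eX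
  exact ⟨C, inferInstance, fun c => (bcFunctor L ℂ).obj (E c), inj, hE', hinj⟩

/-! ## §2 The pieces-free forms: `∇u` on `ℂ`-points, `Alb_u`, `Alb_{u^{K'}_K}` -/

/-- **Every `ℂ`-point of `∇X` lifts along `∇u`, for every surjective `u : Y → X` of smooth projective `k`-schemes** (`k ⊆ ℂ` of
characteristic zero; ANY carriers `∇X`, `∇Y`, `ν` over `u × u`; the complex pieces of `X` and `Y` are supplied by
`exists_isColimit_cofan_complex_of_isSmoothProjective`).  [Lang1983AbelianVarieties] II §3 Prop. 7 at the level of `∇`, no flatness of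
`u`. [cite: Liu2021, §2.1 Def. 2.1 (1) (l. 1171–1176) and §4.2 l. 2060–2072] [cite: Lang1983AbelianVarieties, Ch. II §3 Prop. 7 (p. 48)] -/
theorem Nabla.exists_comp_eq_of_surjective_of_smooth [CharZero k] {d d' : ℕ} {X Y : SchemeOver k}
    [SmoothOfRelativeDimension d X.hom] [SmoothOfRelativeDimension d' Y.hom] (hX : IsProjectiveOver X)
    (hY : IsProjectiveOver Y) (N : Nabla X) (N' : Nabla Y) (u : Y ⟶ X) [Surjective u.left] (ν : N'.N ⟶ N.N)
    (hν : ν ≫ N.incl = N'.incl ≫ (u ⊗ₘ u)) :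
    ∀ Pt : AlgPoints N.N ℂ, ∃ Q : AlgPoints N'.N ℂ, Q ≫ ν = Pt := by
  obtain ⟨κ, _, P, inj, hP, ⟨hcol⟩⟩ := exists_isColimit_cofan_complex_of_isSmoothProjective (d := d) X hX
  obtain ⟨κ', _, P', inj', hP', ⟨hcol'⟩⟩ := exists_isColimit_cofan_complex_of_isSmoothProjective (d := d') Y hY
  haveI : ∀ c, GeometricallyIrreducible (P c).hom := fun c => (hP c).geometricallyIrreducible
  haveI : ∀ c', GeometricallyIrreducible (P' c').hom := fun c' => (hP' c').geometricallyIrreducible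
  exact Nabla.exists_comp_eq_of_surjective_of_isProjectiveOver (d := d) hX hY N N' u ν hν inj hcol inj' hcol'

/-- **`Alb_u : Alb_Y → Alb_X` is an EPIMORPHISM for every SURJECTIVE morphism `u : Y → X` of smooth projective schemes over a field
`k ⊆ ℂ` of characteristic zero** — [Lang1983AbelianVarieties] Ch. II §3 Prop. 7 («if `φ` is generically surjective then `φ_*` is
generically surjective»; `φ_*` of Prop. 5) in Liu's `∇`-normalisation (Def. 2.3: `Alb_u ∘ α_Y = α_X ∘ ∇u`), for possibly REDUCIBLE
pure-dimensional `X`, `Y`, WITHOUT flatness of `u` (compare ★ `Albanese.epi_map_of_surjective`, which needs `u` universally open).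
The complex pieces are supplied by `exists_isColimit_cofan_complex_of_isSmoothProjective`.  (Name: the ★ flat-route lemma of
`AppendixC/AlbaneseTraceIsogeny` already owns `Albanese.epi_map_of_surjective_of_smooth`.)
[cite: Lang1983AbelianVarieties, Ch. II §3 Prop. 5 (p. 47) and Prop. 7 (p. 48)] [cite: Liu2021, Def. 2.3 (l. 1202–1208) and §4.2 l. 2064–2072] -/
theorem Albanese.epi_map_of_surjective_of_isSmoothProjective [CharZero k] {d d' : ℕ} {X Y : SchemeOver k}
    [SmoothOfRelativeDimension d X.hom] [SmoothOfRelativeDimension d' Y.hom] (hX : IsProjectiveOver X)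
    (hY : IsProjectiveOver Y) (aY : Albanese Y) (aX : Albanese X) (u : Y ⟶ X) [Surjective u.left] :
    Epi (aY.map aX u) := by
  obtain ⟨κ, _, P, inj, hP, ⟨hcol⟩⟩ := exists_isColimit_cofan_complex_of_isSmoothProjective (d := d) X hX
  obtain ⟨κ', _, P', inj', hP', ⟨hcol'⟩⟩ := exists_isColimit_cofan_complex_of_isSmoothProjective (d := d') Y hY
  haveI : ∀ c, GeometricallyIrreducible (P c).hom := fun c => (hP c).geometricallyIrreducible
  haveI : ∀ c', GeometricallyIrreducible (P' c').hom := fun c' => (hP' c').geometricallyIrreducible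
  exact Albanese.epi_map_of_surjective_of_pieces (d := d) hX hY aY aX u inj hcol inj' hcol'

end ComplexPieces

/-! ## §3 `∇u` is a SURJECTIVE morphism of schemes (not only on `ℂ`-points) -/

section SchemeSurjective

open AbelianVariety (bcSpec bcFunctor)

set_option backward.isDefEq.respectTransparency false

/-- **A universally closed `K`-morphism onto which every `Ω`-point lifts is surjective** (`Ω ⊇ K` algebraically closed, target locally
of finite type over `K`): the image is closed (`u` closed) and contains every closed point `z` — `κ(z)` is finite over `K` (the target is
Jacobson), so `z` underlies an `Ω`-point (★ `Motives.exists_point_through_closedPoint`), which lifts by hypothesis — and the closed points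
of a Jacobson space are dense (Mathlib `closure_closedPoints`). Ours. [cite: GortzWedhorn2020, Cor. 3.36 (p. 83) and Prop. 3.35]
[cite: StacksProject, Tag 01TB] -/
theorem _root_.Literature.AlgebraicGeometry.Motives.SchemeOver.surjective_left_of_forall_algPoints {K : Type} [Field K]
    (Ω : Type) [Field Ω] [Algebra K Ω] [IsAlgClosed Ω] {W Z : SchemeOver K} (g : W ⟶ Z) [UniversallyClosed g.left]
    [LocallyOfFiniteType Z.hom] (h : ∀ P : AlgPoints Z Ω, ∃ Q : AlgPoints W Ω, Q ≫ g = P) : Surjective g.left := by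
  haveI : JacobsonSpace ↥Z.left := LocallyOfFiniteType.jacobsonSpace Z.hom
  have hclosed : IsClosed (Set.range ⇑g.left) := g.left.isClosedMap.isClosed_range
  -- every closed point underlies an `Ω`-point over `K`, which lifts along `g`
  have hpts : closedPoints ↥Z.left ⊆ Set.range ⇑g.left := by
    intro z hz
    obtain ⟨τ, hτ⟩ := exists_point_through_closedPoint Z.hom Ω (mem_closedPoints_iff.mp hz)
    obtain ⟨Q, hQ⟩ := h (AlgPoints.mk (Spec.map τ ≫ Z.left.fromSpecResidueField z) hτ)
    refine ⟨Q.pt, ?_⟩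
    have hpt : (AlgPoints.map g Q).pt = (AlgPoints.mk (Spec.map τ ≫ Z.left.fromSpecResidueField z) hτ).pt := by
      rw [AlgPoints.map_apply, hQ]
    rw [AlgPoints.pt_map] at hpt
    rw [hpt]
    change (Spec.map τ ≫ Z.left.fromSpecResidueField z) (IsLocalRing.closedPoint Ω) = z
    rw [Scheme.Hom.comp_apply]
    exact Scheme.fromSpecResidueField_apply z _
  -- closed points are dense in the Jacobson space `Z`
  refine ⟨fun z => ?_⟩
  have hz : z ∈ closure (closedPoints ↥Z.left) := by rw [closure_closedPoints]; exact Set.mem_univ z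
  exact (hclosed.closure_subset_iff.mpr hpts) hz

variable {k : Type} [Field k] [Algebra k ℂ]

/-- **`∇u : ∇Y → ∇X` is a SURJECTIVE morphism of schemes for every surjective `u : Y → X` of smooth projective `k`-schemes** (`k ⊆ ℂ` of
characteristic zero; any carriers `∇X`, `∇Y` and `ν` over `u × u`): `ν` is universally closed (`∇Y ↪ Y × Y` is a closed immersion,
`u × u : Y × Y → X × X` is a morphism of proper `k`-schemes, `∇X ↪ X × X` is separated), it hits every `ℂ`-point of `∇X` (§2), and `∇X` is
locally of finite type (★ `NablaSmooth`), so the previous lemma applies.  The flatness-free form of ★ `Nabla.surjective_map_left`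
(`AppendixC/AlbaneseTraceIsogeny`), at the price of smoothness and projectivity of `X` and `Y`.
[cite: Liu2021, §2.1 Def. 2.1 (1) (l. 1171–1176) and §4.2 l. 2060–2072] [cite: Lang1983AbelianVarieties, Ch. II §3 Prop. 7 (p. 48)] -/
theorem Nabla.surjective_left_of_surjective_of_smooth [CharZero k] {d d' : ℕ} {X Y : SchemeOver k}
    [SmoothOfRelativeDimension d X.hom] [SmoothOfRelativeDimension d' Y.hom] (hX : IsProjectiveOver X) (hY : IsProjectiveOver Y)
    (N : Nabla X) (N' : Nabla Y) (u : Y ⟶ X) [Surjective u.left] (ν : N'.N ⟶ N.N) (hν : ν ≫ N.incl = N'.incl ≫ (u ⊗ₘ u)) :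
    Surjective ν.left := by
  haveI : IsProper X.hom := hX.isProper
  haveI : IsProper Y.hom := hY.isProper
  haveI : IsClosedImmersion N'.incl.left := N'.isClosedImmersion_incl
  haveI : IsClosedImmersion N.incl.left := N.isClosedImmersion_incl
  haveI := Nabla.locallyOfFiniteType_hom (d := d) N
  -- `u × u` is universally closed: `(u × u) ≫ (X × X → Spec k) = (Y × Y → Spec k)` is proper and `X × X → Spec k` is separated
  haveI : UniversallyClosed (Y ⊗ Y).hom := by
    rw [Over.tensorObj_hom]
    infer_instance
  haveI : IsSeparated (X ⊗ X).hom := by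
    rw [Over.tensorObj_hom]
    infer_instance
  haveI : UniversallyClosed ((u ⊗ₘ u).left ≫ (X ⊗ X).hom) := by
    rw [Over.w (u ⊗ₘ u)]
    infer_instance
  haveI : UniversallyClosed (u ⊗ₘ u).left := UniversallyClosed.of_comp_of_isSeparated _ (X ⊗ X).hom
  -- hence so is `ν`: `ν ≫ (∇X ↪ X × X) = (∇Y ↪ Y × Y) ≫ (u × u)`
  haveI : UniversallyClosed (ν.left ≫ N.incl.left) := by
    rw [← Over.comp_left, hν, Over.comp_left]
    infer_instance
  haveI : UniversallyClosed ν.left := UniversallyClosed.of_comp_of_isSeparated _ N.incl.left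
  exact SchemeOver.surjective_left_of_forall_algPoints ℂ ν
    (Nabla.exists_comp_eq_of_surjective_of_smooth (d := d) (d' := d') hX hY N N' u ν hν)

end SchemeSurjective

namespace Sec42Data

open AbelianVariety (bcSpec bcFunctor)

set_option backward.isDefEq.respectTransparency false

variable {F E : Type} [Field F] [NumberField F] [NumberField.IsTotallyReal F] [Field E] [NumberField E] [Algebra F E]
  [NumberField.IsTotallyComplex E] [Algebra.IsQuadraticExtension F E]
variable {P5 : PropC5Data F E} {isotropicAt : ℕ → Prop} (C : Sec42Data P5 isotropicAt)

/-- **`Alb_{u^{K'}_K}` is an EPIMORPHISM for every SURJECTIVE transition morphism `u^{K'}_K` of a §4.2 datum** (`E ⊆ ℂ`; NO further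
hypothesis: both levels are smooth projective, §4.2 l. 2064, and their complex pieces come from
`exists_isColimit_cofan_complex_of_isSmoothProjective`).  The flatness-free, pieces-free form of input (I) «`AlbTransitionEpi`» of the
reduction of [Liu2021, Thm. 4.18 (1)] (l. 2064 «generically finite dominant»; [Lang1983AbelianVarieties] II §3 Prop. 7).
[cite: Liu2021, §4.2 l. 2060–2072 and Thm. 4.18 (1) proof l. 2247–2282; Def. 2.3] [cite: Lang1983AbelianVarieties, Ch. II §3 Prop. 7 (p. 48)] -/
theorem epi_Atr_of_surjective_transition [Algebra E ℂ] {K K' : C5.SmallLevel C.S.K₀} (f : K' ⟶ K)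
    [Surjective (C.cpt.X.map f).left] : Epi (C.Atr f) := by
  haveI := C.cpt.smooth_X K
  haveI := C.cpt.smooth_X K'
  obtain ⟨κ, _, P, inj, hP, ⟨hcol⟩⟩ :=
    exists_isColimit_cofan_complex_of_isSmoothProjective (d := P5.n - 1) (C.X K) (C.cpt.projective_X K)
  obtain ⟨κ', _, P', inj', hP', ⟨hcol'⟩⟩ :=
    exists_isColimit_cofan_complex_of_isSmoothProjective (d := P5.n - 1) (C.X K') (C.cpt.projective_X K')
  haveI : ∀ c, GeometricallyIrreducible (P c).hom := fun c => (hP c).geometricallyIrreducible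
  haveI : ∀ c', GeometricallyIrreducible (P' c').hom := fun c' => (hP' c').geometricallyIrreducible
  exact C.epi_Atr_of_surjective f inj hcol inj' hcol'

end Sec42Data

end Literature.NumberTheory.Automorphic.Liu2021.AppendixC

end
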